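import Summits.ValiantsHypothesis.ValiantsHypothesis.Theorems.KPlusLogSqLawTropicalBMarkedEdgeCoreWalks
import Summits.ValiantsHypothesis.ValiantsHypothesis.Theorems.KPlusLogSqLawTropicalBMarkedEdgeCorePrefixRigidity

/-!
# Route «KPlusLogSqLaw», crux `TropicalB` (stmt-ValiantsHypothesis-19771) — MARKED-EDGE sector, NESTED-TRIANGLE CORE, ALL sizes:
# THEOREM K1-J — the ρ-free rigidity theorem behind most of THEOREM D1

HONEST FRAMING.  Helper file (cell `pub-symmetroid`, seat val-sym-trop-p4 (g21), 2026-08-29; `--supports stmt-ValiantsHypothesis-19771 --as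
helper`).  Kernel version of THEOREM K1-J of this seat's memo HOME/val-sym-trop-p4/g21/RIGIDITY-g21.md §4 (located: it disposes of ≈ 90 % of
all two-colour D1-failures of Regime I without reference to the Q-cover).  Nothing here proves the nested-triangle law itself; nothing concerns
`TropicalB` in its window, `WeakLifting`, the doors, `MatrixDescartes` (stmt-ValiantsHypothesis-18050) or VP ≠ VNP.

READING (relative coordinates `x = σZ⁻¹σB`, `y = σZ⁻¹σC`, `ζ = σZ⁻¹σE`, gates `t = b0`, `s = b4`, marks `p = b1`, `q = b2`, `r = b3`, `k⁺ = σZ⁻¹ b_k`;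
a relative arc `i → j` of colour `X` means `σZ j = σX i`; «rising walks» never touch `b4` and touch `b0` only at an end).
**THEOREM `core_K1J`.**  In a realisation of the nested-triangle core it is impossible that simultaneously
 (i)  `b0` is reachable from `r⁺ = σZ⁻¹ b3` by a rising walk with arcs of `x, y, ζ`;
 (ii) `p = b1` is reachable from `b0` by a rising walk with arcs of `x, y, ζ`;
 (iii) `b0` is reachable from `p⁺ = σZ⁻¹ b1` by a rising walk with arcs of `x, ζ`;
 (iv) `p` lies on the `x`-chain of `q = b2` (`p = xᵏ q`, the chain staying off the gates).
PROOF (memo §4): (i) + `core_noWalk_three` ⇒ `r` is unreachable from `b0` (three colours); `prefix_rigidity` (pair exchange (C,E)) ⇒ `y, ζ` agree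
along their `b4`-prefixes up to `r`.  (iii) + `core_noWalkBE` ⇒ `p` is unreachable by `x, ζ`, hence so is its `x`-ancestor `q` (iv);
`prefix_rigidity_high` (pair exchange (B,E), witness `p` above `q`) ⇒ `x, ζ` agree along their `b4`-prefixes up to `q`.  Both prefixes live on
the one `b4`-chain of `ζ`: if `r` comes first then `x r = ζ r = r⁺`, i.e. `σB b3 = b3`; if `q` comes first then `y q = ζ q = q⁺`, i.e. `σC b2 = b2`;
both excluded by the patterns.
-/

set_option linter.dupNamespace false
set_option autoImplicit false

namespace Summit.ValiantsHypothesis.ValiantsHypothesis.Theorems.KPlusLogSqLaw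
namespace MarkedEdge
namespace Core

open Finset

variable {V : Type*} [Fintype V] [DecidableEq V]

omit [Fintype V] [DecidableEq V] in
/-- **Closing a walk.**  An up-walk `t ⇝ k` (steps `A`, never entering `s` or `t`), one arc `k → k'`, and a down-walk `k' ⇝ t` (sources off
the gates) concatenate to a closed walk `f 0 = t, …, f n = t` of length `n ≥ 2` whose inner nodes avoid `s, t`, passing the arc `k → k'` at
some position `a < n`. [folklore] -/
theorem closedWalk_of_reach (A : V → V → Prop) (s t k k' : V)
    (hup : Relation.TransGen (fun i j => i ≠ s ∧ j ≠ s ∧ j ≠ t ∧ i ≠ j ∧ A i j) t k)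
    (hkk' : A k k') (hkk : k ≠ k')
    (hdown : k' = t ∨ Relation.TransGen (fun i j => i ≠ s ∧ i ≠ t ∧ j ≠ s ∧ i ≠ j ∧ A i j) k' t) :
    ∃ (f : ℕ → V) (n : ℕ), 2 ≤ n ∧ f 0 = t ∧ f n = t ∧ (∀ i, 1 ≤ i → i < n → f i ≠ t ∧ f i ≠ s) ∧
      (∀ i, i < n → f (i + 1) ≠ f i) ∧ (∀ i, i < n → A (f i) (f (i + 1))) ∧ ∃ a, a < n ∧ f a = k ∧ f (a + 1) = k' := by
  obtain ⟨n₁, hn₁, f₁, hf₁0, hf₁n, hR₁⟩ := walk_of_transGen _ hup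
  -- inner nodes of the up-walk: f₁ i for 1 ≤ i ≤ n₁ avoid s and t
  have hW₁ : ∀ i, 1 ≤ i → i ≤ n₁ → f₁ i ≠ t ∧ f₁ i ≠ s := by
    intro i hi1 hi2
    have := hR₁ (i - 1) (by omega)
    rw [show i - 1 + 1 = i by omega] at this
    exact ⟨this.2.2.1, this.2.1⟩
  rcases hdown with hk't | hdown
  · -- the arc lands at t directly
    refine ⟨fun i => if i ≤ n₁ then f₁ i else t, n₁ + 1, by omega, by simp [hf₁0], by simp, ?_, ?_, ?_, n₁, by omega, by simp [hf₁n], ?_⟩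
    · intro i hi1 hi2
      have : i ≤ n₁ := by omega
      simp only [this, if_true]; exact hW₁ i hi1 this
    · intro i hi
      by_cases hin : i + 1 ≤ n₁
      · have hi' : i ≤ n₁ := by omega
        simp only [hin, hi', if_true]; exact (hR₁ i (by omega)).2.2.2.1.symm
      · have hi' : i = n₁ := by omega
        subst hi'
        simp only [hin, if_false, le_refl, if_true, hf₁n]; rw [← hk't]; exact hkk.symm
    · intro i hi
      by_cases hin : i + 1 ≤ n₁
      · have hi' : i ≤ n₁ := by omega
        simp only [hin, hi', if_true]; exact (hR₁ i (by omega)).2.2.2.2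
      · have hi' : i = n₁ := by omega
        subst hi'
        simp only [hin, if_false, le_refl, if_true, hf₁n]; rw [← hk't]; exact hkk'
    · have : ¬ (n₁ + 1 ≤ n₁) := by omega
      simp only [this, if_false]; exact hk't.symm
  · obtain ⟨n₂, hn₂, f₂, hf₂0, hf₂n, hR₂⟩ := walk_of_transGen _ hdown
    have hW₂ : ∀ i, i < n₂ → f₂ i ≠ t ∧ f₂ i ≠ s := fun i hi => ⟨(hR₂ i hi).2.1, (hR₂ i hi).1⟩
    refine ⟨fun i => if i ≤ n₁ then f₁ i else f₂ (i - n₁ - 1), n₁ + 1 + n₂, by omega, by simp [hf₁0], ?_, ?_, ?_, ?_,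
      n₁, by omega, by simp [hf₁n], ?_⟩
    · have : ¬ (n₁ + 1 + n₂ ≤ n₁) := by omega
      simp only [this, if_false, show n₁ + 1 + n₂ - n₁ - 1 = n₂ by omega, hf₂n]
    · intro i hi1 hi2
      by_cases hin : i ≤ n₁
      · simp only [hin, if_true]; exact hW₁ i hi1 hin
      · simp only [hin, if_false]; exact hW₂ (i - n₁ - 1) (by omega)
    · intro i hi
      by_cases hin : i + 1 ≤ n₁
      · have hi' : i ≤ n₁ := by omega
        simp only [hin, hi', if_true]; exact (hR₁ i (by omega)).2.2.2.1.symm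
      · by_cases hi' : i ≤ n₁
        · have hieq : i = n₁ := by omega
          subst hieq
          simp only [hin, if_false, le_refl, if_true, hf₁n, show i + 1 - i - 1 = 0 by omega, hf₂0]; exact hkk.symm
        · simp only [hin, hi', if_false, show i + 1 - n₁ - 1 = (i - n₁ - 1) + 1 by omega]
          exact (hR₂ (i - n₁ - 1) (by omega)).2.2.2.1.symm
    · intro i hi
      by_cases hin : i + 1 ≤ n₁
      · have hi' : i ≤ n₁ := by omega
        simp only [hin, hi', if_true]; exact (hR₁ i (by omega)).2.2.2.2
      · by_cases hi' : i ≤ n₁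
        · have hieq : i = n₁ := by omega
          subst hieq
          simp only [hin, if_false, le_refl, if_true, hf₁n, show i + 1 - i - 1 = 0 by omega, hf₂0]; exact hkk'
        · simp only [hin, hi', if_false, show i + 1 - n₁ - 1 = (i - n₁ - 1) + 1 by omega]
          exact (hR₂ (i - n₁ - 1) (by omega)).2.2.2.2
    · have : ¬ (n₁ + 1 ≤ n₁) := by omega
      simp only [this, if_false, show n₁ + 1 - n₁ - 1 = 0 by omega, hf₂0]


omit [Fintype V] [DecidableEq V] in
/-- **Predecessor closure of the unreachable set.**  For the up-walk relation `R i j := i ≠ s ∧ j ≠ s ∧ j ≠ t ∧ i ≠ j ∧ A i j` and a map `c`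
whose non-loop arcs are `A`-arcs: if `c i` is a non-gate node unreachable from `t`, then so is `i`, unless `i = s`. [folklore] -/
theorem unreach_pred (A : V → V → Prop) (c : V → V) (s t : V) (hA : ∀ i, c i ≠ i → A i (c i)) (i : V)
    (hci : c i ≠ s ∧ c i ≠ t ∧ ¬ Relation.TransGen (fun i j => i ≠ s ∧ j ≠ s ∧ j ≠ t ∧ i ≠ j ∧ A i j) t (c i))
    (hmov : c i ≠ i) :
    (i ≠ s ∧ i ≠ t ∧ ¬ Relation.TransGen (fun i j => i ≠ s ∧ j ≠ s ∧ j ≠ t ∧ i ≠ j ∧ A i j) t i) ∨ i = s := by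
  by_cases his : i = s
  · exact Or.inr his
  · refine Or.inl ⟨his, fun hit => ?_, fun hreach => ?_⟩
    · subst hit
      exact hci.2.2 (Relation.TransGen.single ⟨his, hci.1, hci.2.1, fun h' => hmov h'.symm, hA i hmov⟩)
    · exact hci.2.2 (hreach.tail ⟨his, hci.1, hci.2.1, fun h' => hmov h'.symm, hA i hmov⟩)


section Core

variable (ok : V → V → Prop) (w g : V → V → ℤ) (b : Fin 5 → V)

/-- **THEOREM K1-J (ρ-free rigidity theorem; kernel form).**  See the module docstring: in a realisation of the nested-triangle core the four
reachability facts (i) `σZ⁻¹ b3 ⇝ b0` (colours B, C, E), (ii) `b0 ⇝ b1` (colours B, C, E), (iii) `σZ⁻¹ b1 ⇝ b0` (colours B, E),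
(iv) `b1` on the relative `σB`-chain of `b2`, cannot hold together. [this seat's theorem — THEOREM K1-J of RIGIDITY-g21.md] -/
theorem core_K1J (hb : Function.Injective b)
    (hoff : ∀ i j, j ≠ i → g i j = 0) (hmark : ∀ l, g (b l) (b l) = (2 : ℤ) ^ (l : ℕ)) (haux : ∀ i, (∀ l, b l ≠ i) → g i i = 0)
    {θB θC θE θZ : ℤ} {σB σC σE σZ : Equiv.Perm V} (hBC : θB < θC) (hCE : θC < θE) (hEZ : θE < θZ)
    (hB : (∀ i, ok i (σB i)) ∧ ∀ τ : Equiv.Perm V, τ ≠ σB → (∀ i, ok i (τ i)) →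
      ∑ i, (w i (τ i) + θB * g i (τ i)) < ∑ i, (w i (σB i) + θB * g i (σB i)))
    (hC : (∀ i, ok i (σC i)) ∧ ∀ τ : Equiv.Perm V, τ ≠ σC → (∀ i, ok i (τ i)) →
      ∑ i, (w i (τ i) + θC * g i (τ i)) < ∑ i, (w i (σC i) + θC * g i (σC i)))
    (hE : (∀ i, ok i (σE i)) ∧ ∀ τ : Equiv.Perm V, τ ≠ σE → (∀ i, ok i (τ i)) →
      ∑ i, (w i (τ i) + θE * g i (τ i)) < ∑ i, (w i (σE i) + θE * g i (σE i)))
    (hZ : (∀ i, ok i (σZ i)) ∧ ∀ τ : Equiv.Perm V, τ ≠ σZ → (∀ i, ok i (τ i)) →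
      ∑ i, (w i (τ i) + θZ * g i (τ i)) < ∑ i, (w i (σZ i) + θZ * g i (σZ i)))
    (hB0 : σB (b 0) ≠ b 0) (hB1 : σB (b 1) = b 1) (hB2 : σB (b 2) = b 2) (hB3 : σB (b 3) ≠ b 3) (hB4 : σB (b 4) ≠ b 4)
    (hC0 : σC (b 0) ≠ b 0) (hC1 : σC (b 1) = b 1) (hC2 : σC (b 2) ≠ b 2) (hC3 : σC (b 3) = b 3) (hC4 : σC (b 4) ≠ b 4)
    (hE0 : σE (b 0) ≠ b 0) (hE1 : σE (b 1) ≠ b 1) (hE2 : σE (b 2) = b 2) (hE3 : σE (b 3) = b 3) (hE4 : σE (b 4) ≠ b 4)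
    (hZ0 : σZ (b 0) = b 0) (hZ1 : σZ (b 1) ≠ b 1) (hZ2 : σZ (b 2) ≠ b 2) (hZ3 : σZ (b 3) ≠ b 3) (hZ4 : σZ (b 4) = b 4)
    (hr : Relation.TransGen (fun i j => i ≠ b 4 ∧ i ≠ b 0 ∧ j ≠ b 4 ∧ i ≠ j ∧
      (σZ j = σB i ∨ σZ j = σC i ∨ σZ j = σE i)) (σZ⁻¹ (b 3)) (b 0))
    (hp : Relation.TransGen (fun i j => i ≠ b 4 ∧ j ≠ b 4 ∧ j ≠ b 0 ∧ i ≠ j ∧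
      (σZ j = σB i ∨ σZ j = σC i ∨ σZ j = σE i)) (b 0) (b 1))
    (hp' : Relation.TransGen (fun i j => i ≠ b 4 ∧ i ≠ b 0 ∧ j ≠ b 4 ∧ i ≠ j ∧
      (σZ j = σB i ∨ σZ j = σE i)) (σZ⁻¹ (b 1)) (b 0))
    (hqp : ∃ k : ℕ, ((σZ⁻¹ * σB) ^ k) (b 2) = b 1 ∧ ∀ i, i ≤ k → ((σZ⁻¹ * σB) ^ i) (b 2) ≠ b 0 ∧ ((σZ⁻¹ * σB) ^ i) (b 2) ≠ b 4) :
    False := by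
  classical
  -- names
  set s := b 4 with hs
  set t := b 0 with ht
  set x : Equiv.Perm V := σZ⁻¹ * σB with hxdef
  set y : Equiv.Perm V := σZ⁻¹ * σC with hydef
  set ζ : Equiv.Perm V := σZ⁻¹ * σE with hζdef
  have hxa : ∀ i, σZ (x i) = σB i := fun i => by simp [hxdef]
  have hya : ∀ i, σZ (y i) = σC i := fun i => by simp [hydef]
  have hζa : ∀ i, σZ (ζ i) = σE i := fun i => by simp [hζdef]
  have hst : s ≠ t := fun h' => by have := hb h'; simp at this
  have hb12 : b 1 ≠ b 2 := fun h' => by have := hb h'; simp at this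
  have hb13 : b 1 ≠ b 3 := fun h' => by have := hb h'; simp at this
  have hb23 : b 2 ≠ b 3 := fun h' => by have := hb h'; simp at this
  have hb10 : b 1 ≠ b 0 := fun h' => by have := hb h'; simp at this
  have hb14 : b 1 ≠ b 4 := fun h' => by have := hb h'; simp at this
  have hb20 : b 2 ≠ b 0 := fun h' => by have := hb h'; simp at this
  have hb24 : b 2 ≠ b 4 := fun h' => by have := hb h'; simp at this
  have hb30 : b 3 ≠ b 0 := fun h' => by have := hb h'; simp at this
  have hb34 : b 3 ≠ b 4 := fun h' => by have := hb h'; simp at this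
  -- marks in relative form
  have hxr : x (b 3) ≠ σZ⁻¹ (b 3) := fun h' => hB3 (by have := congrArg σZ h'; simpa [hxdef] using this)
  have hyr : y (b 3) = σZ⁻¹ (b 3) := by apply σZ.injective; simp [hydef, hC3]
  have hζr : ζ (b 3) = σZ⁻¹ (b 3) := by apply σZ.injective; simp [hζdef, hE3]
  have hxp : x (b 1) = σZ⁻¹ (b 1) := by apply σZ.injective; simp [hxdef, hB1]
  have hyp : y (b 1) = σZ⁻¹ (b 1) := by apply σZ.injective; simp [hydef, hC1]
  have hζp : ζ (b 1) ≠ σZ⁻¹ (b 1) := fun h' => hE1 (by have := congrArg σZ h'; simpa [hζdef] using this)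
  have hxq : x (b 2) = σZ⁻¹ (b 2) := by apply σZ.injective; simp [hxdef, hB2]
  have hyq : y (b 2) ≠ σZ⁻¹ (b 2) := fun h' => hC2 (by have := congrArg σZ h'; simpa [hydef] using this)
  have hζq : ζ (b 2) = σZ⁻¹ (b 2) := by apply σZ.injective; simp [hζdef, hE2]
  have hr'ne : σZ⁻¹ (b 3) ≠ b 3 := fun h' => hZ3 (by have := congrArg σZ h'; simpa using this.symm)
  have hp'ne : σZ⁻¹ (b 1) ≠ b 1 := fun h' => hZ1 (by have := congrArg σZ h'; simpa using this.symm)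
  have hq'ne : σZ⁻¹ (b 2) ≠ b 2 := fun h' => hZ2 (by have := congrArg σZ h'; simpa using this.symm)
  -- heights
  obtain ⟨h, hh⟩ := core_exists_height ok w g b hb hoff hmark haux hBC hCE hEZ hB hC hE hZ hB0 hB1 hB2 hB3 hB4 hC0 hC1 hC2 hC3 hC4
    hE0 hE1 hE2 hE3 hE4 hZ0 hZ1 hZ2 hZ3 hZ4
  have hxh : ∀ i, i ≠ s → i ≠ t → x i ≠ s → x i ≠ t → x i ≠ i → h i < h (x i) :=
    fun i h1 h2 h3 h4 h5 => hh i (x i) h2 h1 h4 h3 (Ne.symm h5) (Or.inl (hxa i))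
  have hyh : ∀ i, i ≠ s → i ≠ t → y i ≠ s → y i ≠ t → y i ≠ i → h i < h (y i) :=
    fun i h1 h2 h3 h4 h5 => hh i (y i) h2 h1 h4 h3 (Ne.symm h5) (Or.inr (Or.inl (hya i)))
  have hζh : ∀ i, i ≠ s → i ≠ t → ζ i ≠ s → ζ i ≠ t → ζ i ≠ i → h i < h (ζ i) :=
    fun i h1 h2 h3 h4 h5 => hh i (ζ i) h2 h1 h4 h3 (Ne.symm h5) (Or.inr (Or.inr (hζa i)))
  ------------------------------------------------------------------
  -- STEP 1: `r = b 3` is unreachable from `t` by three colours (L4U in reachability form)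
  ------------------------------------------------------------------
  let A3 : V → V → Prop := fun i j => σZ j = σB i ∨ σZ j = σC i ∨ σZ j = σE i
  let P3 : V → Prop := fun v => v ≠ s ∧ v ≠ t ∧
    ¬ Relation.TransGen (fun i j => i ≠ s ∧ j ≠ s ∧ j ≠ t ∧ i ≠ j ∧ A3 i j) t v
  have hrU : P3 (b 3) := by
    refine ⟨hb34, hb30, fun hreach => ?_⟩
    obtain ⟨f, n, hn, hf0, hfn, hW, hne, harc, a, ha, hfa, hfa1⟩ :=
      closedWalk_of_reach A3 s t (b 3) (σZ⁻¹ (b 3)) hreach (Or.inr (Or.inl (by simp [hC3]))) (Ne.symm hr'ne) (Or.inr hr)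
    exact core_noWalk_three ok w g b hb hoff hmark haux hBC hCE hEZ hB hC hE hZ hB0 hB1 hB2 hB3 hB4 hC0 hC1 hC2 hC3 hC4
      hE0 hE1 hE2 hE3 hE4 hZ0 hZ1 hZ2 hZ3 hZ4 f n hn hf0 hfn (fun i h1 h2 => hW i h1 h2) hne harc ha hfa (by rw [hfa1]; simp)
  -- the unreachable set as a Finset, closed under y- and ζ-predecessors
  set U3 : Finset V := Finset.univ.filter P3 with hU3
  have memU3 : ∀ v, v ∈ U3 ↔ P3 v := fun v => by simp [hU3]
  have hsU3 : s ∉ U3 := fun h' => ((memU3 s).mp h').1 rfl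
  have htU3 : t ∉ U3 := fun h' => ((memU3 t).mp h').2.1 rfl
  have hU3y : ∀ i, y i ∈ U3 → y i ≠ i → i ∈ U3 ∨ i = s := by
    intro i hi hmov
    rcases unreach_pred A3 y s t (fun j _ => Or.inr (Or.inl (hya j))) i ((memU3 _).mp hi) hmov with h' | h'
    · exact Or.inl ((memU3 i).mpr h')
    · exact Or.inr h'
  have hU3ζ : ∀ i, ζ i ∈ U3 → ζ i ≠ i → i ∈ U3 ∨ i = s := by
    intro i hi hmov
    rcases unreach_pred A3 ζ s t (fun j _ => Or.inr (Or.inr (hζa j))) i ((memU3 _).mp hi) hmov with h' | h'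
    · exact Or.inl ((memU3 i).mpr h')
    · exact Or.inr h'
  ------------------------------------------------------------------
  -- STEP 2: y and ζ agree along their s-prefixes up to r
  ------------------------------------------------------------------
  have hrU3 : b 3 ∈ U3 := (memU3 _).mpr hrU
  have hymov : y (b 3) ≠ b 3 := by rw [hyr]; exact hr'ne
  have hζmov : ζ (b 3) ≠ b 3 := by rw [hζr]; exact hr'ne
  obtain ⟨ny, hny, hyr', hyU⟩ := backward_orbit y s t h hyh U3 hsU3 htU3 hU3y (h (b 3)) (b 3) le_rfl hrU3 hymov
  obtain ⟨nζ, hnζ, hζr', hζU⟩ := backward_orbit ζ s t h hζh U3 hsU3 htU3 hU3ζ (h (b 3)) (b 3) le_rfl hrU3 hζmov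
  have hcCE : (y⁻¹ * ζ).IsCycle := by
    have : y⁻¹ * ζ = σC⁻¹ * σE := by simp [hydef, hζdef, mul_assoc]
    rw [this]
    exact core_CE_isCycle ok w g b hb hoff hmark haux hCE hC hE hC0 hC1 hC2 hC3 hC4 hE0 hE1 hE2 hE3 hE4
  have hpU3 : b 1 ∉ U3 := fun h' => ((memU3 _).mp h').2.2 hp
  have hyζp : y (b 1) ≠ ζ (b 1) := by rw [hyp]; exact fun h' => hζp h'.symm
  obtain ⟨hnyζ, hagree_r⟩ := prefix_rigidity y ζ hcCE s t h hyh hζh U3 hsU3 htU3 hU3y hU3ζ hny hnζ hyU hζU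
    (by rw [hyr', hζr']) hyζp hpU3 hb14
  ------------------------------------------------------------------
  -- STEP X: p is unreachable by x, ζ (L4BE in reachability form); hence so is q; x and ζ agree up to q
  ------------------------------------------------------------------
  let A2 : V → V → Prop := fun i j => σZ j = σB i ∨ σZ j = σE i
  let P2 : V → Prop := fun v => v ≠ s ∧ v ≠ t ∧
    ¬ Relation.TransGen (fun i j => i ≠ s ∧ j ≠ s ∧ j ≠ t ∧ i ≠ j ∧ A2 i j) t v
  have hpU : P2 (b 1) := by
    refine ⟨hb14, hb10, fun hreach => ?_⟩
    obtain ⟨f, n, hn, hf0, hfn, hW, hne, harc, a, ha, hfa, hfa1⟩ :=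
      closedWalk_of_reach A2 s t (b 1) (σZ⁻¹ (b 1)) hreach (Or.inl (by simp [hB1])) (Ne.symm hp'ne) (Or.inr hp')
    exact core_noWalkBE ok w g b hb hoff hmark haux hBC hCE hEZ hB hC hE hZ hB0 hB1 hB2 hB3 hB4 hC0 hC1 hC2 hC3 hC4
      hE0 hE1 hE2 hE3 hE4 hZ0 hZ1 hZ2 hZ3 hZ4 f n hn hf0 hfn (fun i h1 h2 => hW i h1 h2) hne harc ha (l := 1) (Or.inl rfl) hfa
      (by rw [hfa1]; simp)
  set U2 : Finset V := Finset.univ.filter P2 with hU2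
  have memU2 : ∀ v, v ∈ U2 ↔ P2 v := fun v => by simp [hU2]
  have hsU2 : s ∉ U2 := fun h' => ((memU2 s).mp h').1 rfl
  have htU2 : t ∉ U2 := fun h' => ((memU2 t).mp h').2.1 rfl
  have hU2x : ∀ i, x i ∈ U2 → x i ≠ i → i ∈ U2 ∨ i = s := by
    intro i hi hmov
    rcases unreach_pred A2 x s t (fun j _ => Or.inl (hxa j)) i ((memU2 _).mp hi) hmov with h' | h'
    · exact Or.inl ((memU2 i).mpr h')
    · exact Or.inr h'
  have hU2ζ : ∀ i, ζ i ∈ U2 → ζ i ≠ i → i ∈ U2 ∨ i = s := by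
    intro i hi hmov
    rcases unreach_pred A2 ζ s t (fun j _ => Or.inr (hζa j)) i ((memU2 _).mp hi) hmov with h' | h'
    · exact Or.inl ((memU2 i).mpr h')
    · exact Or.inr h'
  -- q is an x-ancestor of p, so q ∈ U2
  obtain ⟨k, hkp, hkW⟩ := hqp
  have hxq_mov : x (b 2) ≠ b 2 := by rw [hxq]; exact hq'ne
  have hqU2 : b 2 ∈ U2 := by
    -- descend from p = x^k q to q
    have : ∀ j, j ≤ k → (x ^ (k - j)) (b 2) ∈ U2 := by
      intro j
      induction j with
      | zero => intro; rw [Nat.sub_zero, hkp]; exact (memU2 _).mpr hpU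
      | succ j ih =>
        intro hj
        have hprev := ih (by omega)
        have heq : k - j = (k - (j + 1)) + 1 := by omega
        rw [heq, pow_succ_apply] at hprev
        rcases hU2x _ hprev (FourBit.pow_apply_ne_self x hxq_mov _) with h' | h'
        · exact h'
        · exact absurd h' (hkW (k - (j + 1)) (by omega)).2
    have := this k le_rfl
    rwa [Nat.sub_self, pow_zero, Equiv.Perm.one_apply] at this
  have hζq_mov : ζ (b 2) ≠ b 2 := by rw [hζq]; exact hq'ne
  obtain ⟨nx, hnx, hxq', hxU⟩ := backward_orbit x s t h hxh U2 hsU2 htU2 hU2x (h (b 2)) (b 2) le_rfl hqU2 hxq_mov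
  obtain ⟨nζ', hnζ', hζq', hζU'⟩ := backward_orbit ζ s t h hζh U2 hsU2 htU2 hU2ζ (h (b 2)) (b 2) le_rfl hqU2 hζq_mov
  have hcBE : (x⁻¹ * ζ).IsCycle := by
    have : x⁻¹ * ζ = σB⁻¹ * σE := by simp [hxdef, hζdef, mul_assoc]
    rw [this]
    exact core_BE_isCycle ok w g b hb hoff hmark haux (hBC.trans hCE) hB hE hB0 hB1 hB2 hB3 hB4 hE0 hE1 hE2 hE3 hE4
  have hxζp : x (b 1) ≠ ζ (b 1) := by rw [hxp]; exact fun h' => hζp h'.symm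
  -- height of p is at least the height of q (p = x^k q along non-gate nodes)
  have hhqp : h ((x ^ nx) s) ≤ h (b 1) := by
    have hxs : x s ≠ s := fun h' => hsU2 (by have := hxU 1 le_rfl hnx; rwa [pow_one, h'] at this)
    have hchain : ∀ j, (x ^ (nx + j)) s = (x ^ j) (b 2) := by
      intro j
      rw [add_comm, pow_add, Equiv.Perm.mul_apply, hxq']
    have hmono := height_mono_chain x s t h hxh hxs (Nat.le_add_right nx k) (fun j hj1 hj2 => by
      have hj : j = nx + (j - nx) := by omega
      rw [hj, hchain]
      exact ⟨(hkW (j - nx) (by omega)).2, (hkW (j - nx) (by omega)).1⟩)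
    rw [hchain k, hkp] at hmono
    omega
  obtain ⟨hnxζ, hagree_q⟩ := prefix_rigidity_high x ζ hcBE s t h hxh hζh U2 hsU2 htU2 hU2x hU2ζ hnx hnζ' hxU hζU'
    (by rw [hxq', hζq']) hxζp hb14 hhqp
  ------------------------------------------------------------------
  -- FINAL: both prefixes live on the s-chain of ζ
  ------------------------------------------------------------------
  -- positions: (ζ^ny) s = r (from y-prefix agreement), (ζ^nx) s = q
  have hζ_r : (ζ ^ ny) s = b 3 := by rw [← hagree_r ny le_rfl, hyr']
  have hζ_q : (ζ ^ nx) s = b 2 := by rw [← hagree_q nx le_rfl, hxq']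
  rcases lt_trichotomy ny nx with hlt | heq | hgt
  · -- r before q on ζ's chain: x agrees with ζ at r, so x r = ζ r = r⁺
    have h1 : (x ^ ny) s = b 3 := by rw [hagree_q ny hlt.le, hζ_r]
    have h2 : (x ^ (ny + 1)) s = (ζ ^ (ny + 1)) s := hagree_q (ny + 1) hlt
    rw [pow_succ_apply, pow_succ_apply, h1, hζ_r, hζr] at h2
    exact hxr h2
  · exact hb23 (by rw [← hζ_q, ← hζ_r, heq])
  · -- q before r: y agrees with ζ at q, so y q = ζ q = q⁺
    have h1 : (y ^ nx) s = b 2 := by rw [hagree_r nx hgt.le, hζ_q]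
    have h2 : (y ^ (nx + 1)) s = (ζ ^ (nx + 1)) s := hagree_r (nx + 1) hgt
    rw [pow_succ_apply, pow_succ_apply, h1, hζ_q, hζq] at h2
    exact hyq h2

end Core

end Core
end MarkedEdge
end Summit.ValiantsHypothesis.ValiantsHypothesis.Theorems.KPlusLogSqLaw
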